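import Literature.AlgebraicGeometry.HodgeTheory.FermatEigenspaceNonvanishing
import Summits.HodgeConjecture.HodgeConjecture.Theorems.PadicSemiregularLiftFermatAnchorAssemblyLevelMapPullback
import HarnessLib

/-!
# Stub `stub_eigenclassExists` of line `witt-lift-rigid-mf` (crux `FermatAnchorAssembly`, stmt-HodgeConjecture-14874)

Z. Ran, *Cycles on Fermat hypersurfaces*, Compositio Math. 42 (1980), §1 Prop. 1.7 (i), EXISTENCE
half: for the Fermat variety `X²ʳₘ` (`r ≥ 1`) and a character `α = (α₀, …, α₂ᵣ₊₁) ∈ (ℤ/m)²ʳ⁺²`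
with all `αᵢ ≠ 0` and `Σ αᵢ = 0`, the eigenspace `V(α) ⊆ H²ʳ(X²ʳₘ(ℂ); ℂ)` of `χ_α` is non-zero
(in print "`dim V(α) = 1`", Shioda 1979 §1, Aoki 1987 p. 385; the upper bound is the tree's
`Ran1980_fermatEigenspace_le_span_holds`). This is VERBATIM the registered stub, and the
hypothesis `hE` of `claimLevelPull_of_exists_eigenclass` (S2↑, the claim pulls back along the level
map). The mathematics is the Literature theorem `Ran1980_fermatEigenspace_ne_bot`
(`Literature/AlgebraicGeometry/HodgeTheory/FermatEigenspaceNonvanishing`): Pham–Brieskorn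
eigenvectors in the homology of the affine piece `U_k = X ∖ Z_k` (Milnor Thm. 9.1), pushed into
`H₂ᵣ(X(ℂ))` and counted against the Alexander–Lefschetz duality
`H₂ᵣ₊₁(X(ℂ), U_k(ℂ)) ≅ H²ʳ⁻¹(X²ʳ⁻¹ₘ(ℂ))` and the odd Betti bound `b₂ᵣ₋₁(X²ʳ⁻¹ₘ) ≤ #𝔄²ʳ⁻¹ₘ`.

The registered stub statement is IDENTICAL to the landed Literature theorem
`Literature.AlgebraicGeometry.HodgeTheory.Ran1980_fermatEigenspace_ne_bot` (p171879), which the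
skeleton should cite BY NAME (a verbatim restatement `stub_eigenclassExists := …` is refused by the
gate as `dedup.landed`); this file records the consumer:

* `claimLevelPull` — S2↑ (the registered `stub_claimLevelPull` statement of gen 9, verbatim), now
  unconditional through `claimLevelPull_of_exists_eigenclass` (p168540) and
  `Ran1980_fermatEigenspace_ne_bot`.
-/

set_option linter.dupNamespace false

noncomputable section

open CategoryTheory AlgebraicGeometry Finset
open Literature.AlgebraicGeometry Literature.AlgebraicGeometry.Motives
open Literature.AlgebraicGeometry.HodgeTheory Literature.AlgebraicGeometry.HodgeTheory.FermatCharacter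
open Literature.AlgebraicTopology.SingularHomology

namespace Summit.HodgeConjecture.HodgeConjecture.Cruxes.FermatAnchorAssembly.WittLiftRigidMf

/-- **S2↑, unconditionally**: the claim pulls back along the level map `[xᵢ] ↦ [xᵢᵏ] : X_{km} → X_m`
(the registered `stub_claimLevelPull` statement of gen 9 verbatim), from
`Ran1980_fermatEigenspace_ne_bot` (= the registered `stub_eigenclassExists`) through
`claimLevelPull_of_exists_eigenclass`. [cite: ShiodaKatsura1979, §1] [cite: Aoki1987, Cor. 2-3] -/
theorem claimLevelPull :
    ∀ (m k r : ℕ) (α' : Fin (2 * r + 2) → ZMod m), 0 < k → (∀ i, α' i ≠ 0) →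
      FermatCharacter.Claim m r α' →
        FermatCharacter.Claim (k * m) r (fun i => ((k * (α' i).val : ℕ) : ZMod (k * m))) :=
  claimLevelPull_of_exists_eigenclass Ran1980_fermatEigenspace_ne_bot

end Summit.HodgeConjecture.HodgeConjecture.Cruxes.FermatAnchorAssembly.WittLiftRigidMf

end
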